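import Summits.CriticalPhenomena.PercolationContinuityZ3.Theorems.Transplant.PathMapCustomers
import HarnessLib

/-!
# `p_c < 1` is a COMMENSURABILITY invariant of Cayley graphs (finite-index subgroups, finite-kernel quotients), kernel — customers of the
# rough-embedding form of the path-map domination principle

builds on p205010 (kernel theorem, internal audit signed; external expert review pending) — nothing in this file uses p205010; unconditional, no node.
Lane `prim-bschramm`, seat `prim-bschramm-p4` gen 24 (PART C3 of `P4-GENERAL.md` §46).  Helper file (`--supports stmt-CriticalPhenomena-4575 --as helper`).

THE POINT.  After `CayleyPathMap.criticalProb_lt_one_of_subgroup` (ascent from ANY subgroup) and gen 23's `CayleyQuot.criticalProb_le` (descent from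
ANY quotient), the two remaining directions that hold only up to FINITENESS:
* **`CayleyComm.criticalProb_lt_one_of_finiteIndex`** — `H ≤ Γ` of FINITE INDEX, `p_c(Cay(Γ;S), g) < 1` ⟹ `p_c(Cay(H;T), h) < 1` for every finite
  generating `T` of `H` (the coset projection `g = h·r ↦ h` along a right transversal `R ∋ 1` is a rough embedding: fibres of size `[Γ:H]`, an `S`-edge
  moves the `H`-part by a Schreier element `r s r'⁻¹ ∈ H`, of bounded `T`-length);
* **`CayleyComm.criticalProb_lt_one_of_quotient_finite_ker`** — `π : Γ ↠ Q` with FINITE kernel, `p_c(Cay(Γ;S), g) < 1` ⟹ `p_c(Cay(Q;π S), π g) < 1`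
  (fibres = cosets of the kernel; an `S`-edge maps to a `π S`-edge or collapses).
So `p_c < 1` (for one, equivalently every, finite generating set) is an invariant of the commensurability class of `Γ` up to finite kernels — the
structural content of Benjamini–Schramm's Conj. 1 discussion ("finite extension of ℤ"), by certificate transfer alone.
[cite: LyonsPeres2016, §7.4 Thm. 7.15 and the remark following it] [cite: BenjaminiSchramm1996, §2 Conj. 1 (Cayley graphs)]
-/

noncomputable section

namespace Summit.CriticalPhenomena.PercolationContinuityZ3.Theorems.Transplant

open SimpleGraph Literature.Probability.Percolation Literature.Probability.LatticeModels Literature.Barriers.CriticalPhenomena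
open scoped Classical

namespace CayleyComm

variable {Γ Q : Type} [Group Γ] [Group Q]

/-! ## §1 Word walks -/

/-- **A word in `T ∪ T⁻¹` without trivial letters is a walk of `Cay(Γ;T)`** from `h` to `h · ∏ l` of length `|l|`. [folklore] -/
theorem exists_walk_word (T : Finset Γ) (l : List Γ) (hl : ∀ y ∈ l, y ≠ 1 ∧ (y ∈ T ∨ y⁻¹ ∈ T)) (h : Γ) :
    ∃ wk : (mulCayley (↑T : Set Γ)).Walk h (h * l.prod), wk.length = l.length := by
  induction l generalizing h with
  | nil => exact ⟨Walk.nil.copy rfl (by simp), by simp⟩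
  | cons y l ih =>
    have hy := hl y (List.mem_cons_self)
    obtain ⟨wk, hwk⟩ := ih (fun z hz => hl z (List.mem_cons_of_mem y hz)) (h * y)
    refine ⟨Walk.cons (CayCyl.adj_mul_of_mem T hy.2 hy.1 h) (wk.copy rfl (by rw [List.prod_cons, mul_assoc])), ?_⟩
    rw [Walk.length_cons, Walk.length_copy, hwk, List.length_cons]

/-! ## §2 Finite-index subgroups -/

/-- **`p_c < 1` DESCENDS TO FINITE-INDEX SUBGROUPS**: `H ≤ Γ` of finite index, `S` a finite generating set of `Γ` with `p_c(Cay(Γ;S), g) < 1`, `T` a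
finite generating set of `H` ⟹ `p_c(Cay(H;T), h₀) < 1` at every `h₀`.  (Coset projection along a right transversal; `GraphPathMap.criticalProb_lt_one_of_lipschitz`.)
[cite: LyonsPeres2016, §7.4 Thm. 7.15 and the remark following it] [cite: BenjaminiSchramm1996, §2 Conj. 1] -/
theorem criticalProb_lt_one_of_finiteIndex (S : Finset Γ) (hS : Subgroup.closure (S : Set Γ) = ⊤) (H : Subgroup Γ) [H.FiniteIndex]
    (T : Finset H) (hT : Subgroup.closure (T : Set H) = ⊤) (g : Γ) (hpc : criticalProb (mulCayley (↑S : Set Γ)) g < 1) (h₀ : H) :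
    criticalProb (mulCayley (↑T : Set H)) h₀ < 1 := by
  haveI : Countable Γ := countable_of_connected_of_locallyFinite _ (CayleyScaled.connected_mulCayley_of_closure S hS) 1
  -- a right transversal `R ∋ 1`, finite
  obtain ⟨R, hR, h1R⟩ := Subgroup.exists_isComplement_right H 1
  have hRcard : R.ncard = H.index := hR.ncard_right
  have hRfin : R.Finite := Set.finite_of_ncard_ne_zero (by rw [hRcard]; exact Subgroup.FiniteIndex.index_ne_zero)
  -- the decomposition `g = proj g · rest g`
  have hdec : ∀ x : Γ, ∃ p : ↥(H : Set Γ) × ↥R, (p.1 : Γ) * (p.2 : Γ) = x := fun x => (hR.existsUnique x).exists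
  choose dec hdec using hdec
  set proj : Γ → H := fun x => ⟨(dec x).1, (dec x).1.2⟩ with hproj
  have hproj_val : ∀ x, ((proj x : H) : Γ) = (dec x).1 := fun x => rfl
  have huniq : ∀ (x : Γ) (h : Γ) (r : Γ), h ∈ H → r ∈ R → h * r = x → ((proj x : H) : Γ) = h := by
    intro x h r hh hr hx
    have := (hR.existsUnique x).unique (y₁ := dec x) (y₂ := (⟨h, hh⟩, ⟨r, hr⟩)) (hdec x) hx
    rw [hproj_val, this]
  -- words in `T` for the Schreier elements
  choose wd hwd using CayleyZSq.exists_word T hT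
  set Spm : Finset Γ := S ∪ S.image (·⁻¹) with hSpm
  set MF : Finset Γ := ((hRfin.toFinset ×ˢ Spm) ×ˢ hRfin.toFinset).image fun q => q.1.1 * q.1.2 * q.2⁻¹ with hMF
  set len : Γ → ℕ := fun m => if hm : m ∈ H then (wd ⟨m, hm⟩).length else 0 with hlen
  set L : ℕ := MF.sup len with hL
  -- (1) Lipschitz: an `S`-edge moves the `H`-part by a Schreier element of `T`-length `≤ L`
  have hLip : ∀ x y, (mulCayley (↑S : Set Γ)).Adj x y → ∃ wk : (mulCayley (↑T : Set H)).Walk (proj x) (proj y), wk.length ≤ L := by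
    intro x y hxy
    obtain ⟨hne, hs⟩ := (mulCayley_adj _ x y).1 hxy
    have hsmem : x⁻¹ * y ∈ Spm := by
      rcases hs with h | h
      · exact Finset.mem_union_left _ (Finset.mem_coe.1 h)
      · exact Finset.mem_union_right _ (Finset.mem_image.2 ⟨y⁻¹ * x, Finset.mem_coe.1 h, by rw [mul_inv_rev, inv_inv]⟩)
    set r : Γ := ((dec x).2 : Γ) with hr
    set r' : Γ := ((dec y).2 : Γ) with hr'
    set m : Γ := r * (x⁻¹ * y) * r'⁻¹ with hm
    have hx : ((proj x : H) : Γ) * r = x := hdec x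
    have hy : ((proj y : H) : Γ) * r' = y := hdec y
    have hmeq : m = ((proj x : H) : Γ)⁻¹ * ((proj y : H) : Γ) := by
      have key : r * ((((proj x : H) : Γ) * r)⁻¹ * (((proj y : H) : Γ) * r')) * r'⁻¹ = ((proj x : H) : Γ)⁻¹ * ((proj y : H) : Γ) := by
        group
      rw [hx, hy] at key
      rw [hm]; exact key
    have hmH : m ∈ H := by rw [hmeq]; exact H.mul_mem (H.inv_mem (proj x).2) (proj y).2
    have hmMF : m ∈ MF := Finset.mem_image.2 ⟨((r, x⁻¹ * y), r'), Finset.mem_product.2 ⟨Finset.mem_product.2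
      ⟨hRfin.mem_toFinset.2 (dec x).2.2, hsmem⟩, hRfin.mem_toFinset.2 (dec y).2.2⟩, rfl⟩
    have hlenm : (wd ⟨m, hmH⟩).length ≤ L := by
      have : len m = (wd ⟨m, hmH⟩).length := by simp only [hlen, dif_pos hmH]
      rw [← this]; exact Finset.le_sup (f := len) hmMF
    obtain ⟨wk, hwk⟩ := exists_walk_word T (wd ⟨m, hmH⟩) (hwd ⟨m, hmH⟩).1 (proj x)
    have htarget : proj x * (wd ⟨m, hmH⟩).prod = proj y := by
      rw [(hwd ⟨m, hmH⟩).2]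
      apply Subtype.ext
      show ((proj x : H) : Γ) * m = ((proj y : H) : Γ)
      rw [hmeq, mul_inv_cancel_left]
    exact ⟨wk.copy rfl htarget, by rw [Walk.length_copy, hwk]; exact hlenm⟩
  -- (2) fibres: `proj⁻¹{h} ⊆ h · R`
  have hK : ∀ h : H, (proj ⁻¹' {h}).Finite ∧ (proj ⁻¹' {h}).ncard ≤ H.index := by
    intro h
    have hsub : proj ⁻¹' {h} ⊆ (fun r : Γ => (h : Γ) * r) '' R := by
      intro x hx
      have hx' : proj x = h := hx
      exact ⟨((dec x).2 : Γ), (dec x).2.2, by rw [← hx']; exact hdec x⟩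
    have hfin : ((fun r : Γ => (h : Γ) * r) '' R).Finite := hRfin.image _
    exact ⟨hfin.subset hsub, (Set.ncard_le_ncard hsub hfin).trans ((Set.ncard_image_le hRfin).trans hRcard.le)⟩
  -- (3) conclude at `proj g`, then move to `h₀`
  have h1 := GraphPathMap.criticalProb_lt_one_of_lipschitz (H := mulCayley (↑S : Set Γ)) (G := mulCayley (↑T : Set H)) proj hLip hK
    (degree_mulCayley_le S) (degree_mulCayley_le T) g hpc
  exact CayleyPathMap.criticalProb_lt_one_of_finset T hT T (proj g) h1 h₀

/-! ## §3 Quotients with finite kernel -/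

/-- **`p_c < 1` DESCENDS TO QUOTIENTS BY FINITE NORMAL SUBGROUPS**: `π : Γ →* Q` surjective with finite kernel, `S` a finite generating set of `Γ` with
`p_c(Cay(Γ;S), g) < 1` ⟹ `p_c(Cay(Q; π S), π g) < 1`.  (Together with gen 23's `CayleyQuot.criticalProb_le` — the opposite inequality for ANY kernel —
`p_c < 1` is invariant under finite-kernel quotients.) [cite: LyonsPeres2016, §7.4 Thm. 7.15 and the remark following it] [cite: BenjaminiSchramm1996, §2 Conj. 1] -/
theorem criticalProb_lt_one_of_quotient_finite_ker (π : Γ →* Q) (hker : (π.ker : Set Γ).Finite) (S : Finset Γ)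
    (hS : Subgroup.closure (S : Set Γ) = ⊤) (g : Γ) (hpc : criticalProb (mulCayley (↑S : Set Γ)) g < 1) :
    criticalProb (mulCayley (↑(S.image π) : Set Q)) (π g) < 1 := by
  haveI : Countable Γ := countable_of_connected_of_locallyFinite _ (CayleyScaled.connected_mulCayley_of_closure S hS) 1
  -- (1) Lipschitz with `L = 1`
  have hLip : ∀ x y, (mulCayley (↑S : Set Γ)).Adj x y → ∃ wk : (mulCayley (↑(S.image π) : Set Q)).Walk (π x) (π y), wk.length ≤ 1 := by
    intro x y hxy
    obtain ⟨-, hs⟩ := (mulCayley_adj _ x y).1 hxy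
    by_cases heq : π x = π y
    · exact ⟨Walk.nil.copy rfl heq, by rw [Walk.length_copy]; exact Nat.zero_le 1⟩
    · have hadj : (mulCayley (↑(S.image π) : Set Q)).Adj (π x) (π y) := by
        rw [mulCayley_adj]
        refine ⟨heq, ?_⟩
        rcases hs with h | h
        · exact Or.inl (by rw [← map_inv, ← map_mul, Finset.coe_image]; exact ⟨_, h, rfl⟩)
        · exact Or.inr (by rw [← map_inv, ← map_mul, Finset.coe_image]; exact ⟨_, h, rfl⟩)
      exact ⟨Walk.cons hadj Walk.nil, by simp⟩
  -- (2) fibres = kernel cosets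
  have hK : ∀ q : Q, (π ⁻¹' {q}).Finite ∧ (π ⁻¹' {q}).ncard ≤ (π.ker : Set Γ).ncard := by
    intro q
    by_cases hq : ∃ x, π x = q
    · obtain ⟨x, rfl⟩ := hq
      have hsub : π ⁻¹' {π x} ⊆ (fun k : Γ => x * k) '' (π.ker : Set Γ) := by
        intro y hy
        have hy' : π y = π x := hy
        refine ⟨x⁻¹ * y, ?_, by show x * (x⁻¹ * y) = y; rw [mul_inv_cancel_left]⟩
        show x⁻¹ * y ∈ π.ker
        rw [MonoidHom.mem_ker, map_mul, map_inv, hy', inv_mul_cancel]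
      have hfin : ((fun k : Γ => x * k) '' (π.ker : Set Γ)).Finite := hker.image _
      exact ⟨hfin.subset hsub, (Set.ncard_le_ncard hsub hfin).trans (Set.ncard_image_le hker)⟩
    · have hempty : π ⁻¹' {q} = ∅ := Set.eq_empty_iff_forall_notMem.2 fun x hx => hq ⟨x, hx⟩
      rw [hempty]
      exact ⟨Set.finite_empty, by rw [Set.ncard_empty]; exact Nat.zero_le _⟩
  exact GraphPathMap.criticalProb_lt_one_of_lipschitz (H := mulCayley (↑S : Set Γ)) (G := mulCayley (↑(S.image π) : Set Q)) π hLip hK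
    (degree_mulCayley_le S) (degree_mulCayley_le (S.image π)) g hpc

end CayleyComm

end Summit.CriticalPhenomena.PercolationContinuityZ3.Theorems.Transplant

end
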